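import Literature.Analysis.Approximation.CarberyWrightProofs
import Mathlib.MeasureTheory.Measure.Hausdorff
import Mathlib.Analysis.SpecialFunctions.Trigonometric.ArctanDeriv
import Mathlib.Analysis.SpecialFunctions.Integrals.Basic
import HarnessLib

/-!
# Mean-relative small balls for non-negative trigonometric polynomials

For a real trigonometric polynomial of degree `≤ D` in exponential form,
`↑(f t) = ∑_{k=-D}^{D} a_k e^{ikt}` (`f : ℝ → ℝ`, `a : ℤ → ℂ`), with `f ≥ 0` and `∫_{[-π,π]} f > 0`:

  `|{t ∈ [-π, π] : f(t) ≤ ε ⨍ f}| ≤ C_D · ε^{1/(2D+2)}`  for every `ε > 0`  (`trigPoly_smallBall`),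

where `⨍ f = (∫_{[-π,π]} f)/(2π)` and `C_D = 288 e √3 (2e·4^D)^{1/(2D+2)}` (not optimised; the sharp
exponent is `1/(2D)`).

## Proof (the classical Remez route)
* `trigPoly_continuous`, `trigPoly_periodic`: `f` is continuous and `2π`-periodic, so it attains its
  maximum `M ≥ ⨍ f` at some `t* ∈ [-π, π]`, globally; `{f ≤ ε ⨍ f} ⊆ {f ≤ ε M}`.
* Half-angle chart (`cexp_two_mul_arctan_mul_I`, `cexp_int_mul_halfAngle`, `trigPoly_halfAngle_poly`):
  on the arc `[c - 2π/3, c + 2π/3] = {c + 2 arctan u : |u| ≤ √3}`,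
  `f(c + 2 arctan u) · (1 + u²)^D = R(u)` for a REAL polynomial `R` of degree `≤ 2D`
  (from `e^{2i arctan u} = (1+iu)/(1-iu)`).
* `volume_le_of_remez`: the sublevel-set form of the (proved) weak Remez inequality
  `Literature.Analysis.Approximation.CarberyWright.remez_weak`. Applied to `R` on `[-√3, √3]` with the
  degree bound `2D + 2` (so that `D = 0` needs no special case) it bounds the chart-side sublevel set;
  the `2`-Lipschitz chart at most doubles Lebesgue measure (`volume_image_halfAngle_le`, via
  `μH[1] = volume`). This is `trigPoly_arc_sublevel`.
* Three arcs centred at `t*`, `t* ± 2π/3` (each containing `t*`) cover the period `[t* - π, t* + π]`,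
  and `[-π, π]` is covered by this period and its two translates by `±2π` (periodicity of `f`,
  translation invariance of `volume`).

Sources: E. J. Remez (1936) for algebraic polynomials; Remez-type inequalities for trigonometric
polynomials: P. Borwein, T. Erdélyi, *Polynomials and Polynomial Inequalities*, GTM 161 (1995), §5.1;
sublevel-set ("small ball") formulations as in A. Carbery, J. Wright, Math. Res. Lett. 8 (2001)
233–248 [CarberyWright2001], Lemma 4. Nikolskii's inequality for the same class of `f` is in
`Literature/Analysis/Fourier/TrigPolyNikolskii.lean`. Everything is proved; no definitions, no
named facts.
-/

noncomputable section

open scoped Real ENNReal NNReal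
open MeasureTheory Set Complex Polynomial

namespace Literature.Analysis.Fourier

/-! ### Continuity and periodicity -/

/-- A real trigonometric polynomial `f` (`↑(f t) = ∑_{|k| ≤ D} a_k e^{ikt}`) is continuous.
[folklore] -/
theorem trigPoly_continuous {D : ℕ} {a : ℤ → ℂ} {f : ℝ → ℝ}
    (hf : ∀ t : ℝ, ((f t : ℝ) : ℂ) =
      ∑ k ∈ Finset.Icc (-(D : ℤ)) D, a k * cexp ((k : ℂ) * (t : ℂ) * I)) :
    Continuous f := by
  have h : f = fun t : ℝ =>
      (∑ k ∈ Finset.Icc (-(D : ℤ)) D, a k * cexp ((k : ℂ) * (t : ℂ) * I)).re := by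
    funext t
    rw [← hf t, Complex.ofReal_re]
  rw [h]
  fun_prop

/-- A real trigonometric polynomial `f` (`↑(f t) = ∑_{|k| ≤ D} a_k e^{ikt}`) is `2π`-periodic.
[folklore] -/
theorem trigPoly_periodic {D : ℕ} {a : ℤ → ℂ} {f : ℝ → ℝ}
    (hf : ∀ t : ℝ, ((f t : ℝ) : ℂ) =
      ∑ k ∈ Finset.Icc (-(D : ℤ)) D, a k * cexp ((k : ℂ) * (t : ℂ) * I)) :
    Function.Periodic f (2 * π) := by
  intro t
  apply Complex.ofReal_injective
  rw [hf, hf]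
  refine Finset.sum_congr rfl fun k _ => ?_
  rw [show (k : ℂ) * ((t + 2 * π : ℝ) : ℂ) * I = (k : ℂ) * (t : ℂ) * I + k * (2 * π * I) by
    push_cast; ring, Complex.exp_add, Complex.exp_int_mul_two_pi_mul_I, mul_one]

/-! ### The half-angle chart `u ↦ c + 2 arctan u` -/

/-- Half-angle identity in exponential form: `e^{2i·arctan u} = (1+iu)/(1-iu)`
(from `cos (arctan u) = 1/√(1+u²)`, `sin (arctan u) = u/√(1+u²)`). [folklore] -/
theorem cexp_two_mul_arctan_mul_I (u : ℝ) :
    cexp (((2 * Real.arctan u : ℝ) : ℂ) * I) = (I * u + 1) / (-I * u + 1) := by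
  have hs' : ((√(1 + u ^ 2) : ℝ) : ℂ) ≠ 0 :=
    Complex.ofReal_ne_zero.2 (Real.sqrt_pos.2 (by positivity)).ne'
  have hs2 : ((√(1 + u ^ 2) : ℝ) : ℂ) ^ 2 = (I * u + 1) * (-I * u + 1) := by
    rw [← Complex.ofReal_pow, Real.sq_sqrt (by positivity)]
    push_cast
    ring_nf
    rw [Complex.I_sq]
    ring
  have hA : (I * u + 1 : ℂ) ≠ 0 := fun h => by
    rw [h, zero_mul] at hs2
    exact hs' ((pow_eq_zero_iff two_ne_zero).1 hs2)
  have hB : (-I * u + 1 : ℂ) ≠ 0 := fun h => by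
    rw [h, mul_zero] at hs2
    exact hs' ((pow_eq_zero_iff two_ne_zero).1 hs2)
  have h1 : cexp (((Real.arctan u : ℝ) : ℂ) * I) = (I * u + 1) / ((√(1 + u ^ 2) : ℝ) : ℂ) := by
    rw [eq_div_iff hs', Complex.exp_mul_I, ← Complex.ofReal_cos, ← Complex.ofReal_sin,
      Real.cos_arctan, Real.sin_arctan]
    push_cast
    field_simp
    ring
  rw [show ((2 * Real.arctan u : ℝ) : ℂ) * I = (2 : ℕ) * (((Real.arctan u : ℝ) : ℂ) * I) by
    push_cast; ring, Complex.exp_nat_mul, h1, div_pow, hs2, div_eq_div_iff (mul_ne_zero hA hB) hB]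
  ring

/-- The characters in the half-angle chart: for `|k| ≤ D`,
`e^{ik(c + 2 arctan u)} (1+u²)^D = e^{ikc} (iu+1)^{k+D} (-iu+1)^{D-k}` — a polynomial of degree `2D` in `u`.
[folklore] -/
theorem cexp_int_mul_halfAngle (D : ℕ) {k : ℤ} (hk : k ∈ Finset.Icc (-(D : ℤ)) D) (c u : ℝ) :
    cexp ((k : ℂ) * ((c + 2 * Real.arctan u : ℝ) : ℂ) * I) * (((1 + u ^ 2) ^ D : ℝ) : ℂ) =
      cexp ((k : ℂ) * (c : ℂ) * I) *
        ((I * u + 1) ^ (k + D).toNat * (-I * u + 1) ^ ((D : ℤ) - k).toNat) := by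
  rw [Finset.mem_Icc] at hk
  have hAB : (((1 + u ^ 2 : ℝ)) : ℂ) = (I * u + 1) * (-I * u + 1) := by
    push_cast
    ring_nf
    rw [Complex.I_sq]
    ring
  have hS : (((1 + u ^ 2 : ℝ)) : ℂ) ≠ 0 := Complex.ofReal_ne_zero.2 (by positivity)
  have hA : (I * u + 1) ≠ 0 := fun h => hS (by rw [hAB, h, zero_mul])
  have hB : (-I * u + 1) ≠ 0 := fun h => hS (by rw [hAB, h, mul_zero])
  have hE := cexp_two_mul_arctan_mul_I u
  have hsplit : cexp ((k : ℂ) * ((c + 2 * Real.arctan u : ℝ) : ℂ) * I) =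
      cexp ((k : ℂ) * (c : ℂ) * I) * cexp ((k : ℂ) * (((2 * Real.arctan u : ℝ) : ℂ) * I)) := by
    rw [← Complex.exp_add]
    congr 1
    push_cast
    ring
  rw [hsplit, mul_assoc]
  congr 1
  rw [Complex.ofReal_pow, hAB]
  generalize I * (u : ℂ) + 1 = A at hA hE ⊢
  generalize -I * (u : ℂ) + 1 = B at hB hE ⊢
  obtain ⟨j, rfl | rfl⟩ := Int.eq_nat_or_neg k
  · obtain ⟨r, rfl⟩ := Nat.exists_eq_add_of_le (by exact_mod_cast hk.2 : j ≤ D)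
    have hm : ((j : ℤ) + ((j + r : ℕ) : ℤ)).toNat = 2 * j + r := by omega
    have hn : (((j + r : ℕ) : ℤ) - (j : ℤ)).toNat = r := by omega
    rw [hm, hn, show ((j : ℤ) : ℂ) * (((2 * Real.arctan u : ℝ) : ℂ) * I) =
      (j : ℕ) * (((2 * Real.arctan u : ℝ) : ℂ) * I) by push_cast; ring, Complex.exp_nat_mul, hE,
      div_pow, div_mul_eq_mul_div, div_eq_iff (pow_ne_zero _ hB)]
    ring
  · obtain ⟨r, rfl⟩ := Nat.exists_eq_add_of_le (by have := hk.1; omega : j ≤ D)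
    have hm : (-(j : ℤ) + ((j + r : ℕ) : ℤ)).toNat = r := by omega
    have hn : (((j + r : ℕ) : ℤ) - -(j : ℤ)).toNat = 2 * j + r := by omega
    rw [hm, hn, show ((-(j : ℤ) : ℤ) : ℂ) * (((2 * Real.arctan u : ℝ) : ℂ) * I) =
      -((j : ℕ) * (((2 * Real.arctan u : ℝ) : ℂ) * I)) by push_cast; ring, Complex.exp_neg,
      Complex.exp_nat_mul, hE, ← inv_pow, inv_div, div_pow, div_mul_eq_mul_div,
      div_eq_iff (pow_ne_zero _ hA)]
    ring

/-- **Algebraic model of a trigonometric polynomial in the half-angle chart.** If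
`↑(f t) = ∑_{|k| ≤ D} a_k e^{ikt}` then for every centre `c` there is a real polynomial `R` of degree
`≤ 2D` with `R(u) = f(c + 2 arctan u) · (1+u²)^D` for all real `u` (the classical substitution
`u = tan((t-c)/2)`). [folklore] -/
theorem trigPoly_halfAngle_poly {D : ℕ} {a : ℤ → ℂ} {f : ℝ → ℝ}
    (hf : ∀ t : ℝ, ((f t : ℝ) : ℂ) = ∑ k ∈ Finset.Icc (-(D : ℤ)) D, a k * cexp ((k : ℂ) * (t : ℂ) * I))
    (c : ℝ) : ∃ R : ℝ[X], R.natDegree ≤ 2 * D ∧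
      ∀ u : ℝ, R.eval u = f (c + 2 * Real.arctan u) * (1 + u ^ 2) ^ D := by
  have hA1 : (Polynomial.C I * (X : ℂ[X]) + Polynomial.C (1 : ℂ)).natDegree ≤ 1 :=
    natDegree_linear_le
  have hB1 : (Polynomial.C (-I) * (X : ℂ[X]) + Polynomial.C (1 : ℂ)).natDegree ≤ 1 :=
    natDegree_linear_le
  obtain ⟨Q, hQdeg, hQeval⟩ : ∃ Q : ℂ[X], Q.natDegree ≤ 2 * D ∧
      ∀ u : ℝ, Q.eval (u : ℂ) = ((f (c + 2 * Real.arctan u) * (1 + u ^ 2) ^ D : ℝ) : ℂ) := by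
    refine ⟨∑ k ∈ Finset.Icc (-(D : ℤ)) D,
      Polynomial.C (a k * cexp ((k : ℂ) * (c : ℂ) * I)) *
        ((Polynomial.C I * (X : ℂ[X]) + Polynomial.C (1 : ℂ)) ^ (k + D).toNat *
          (Polynomial.C (-I) * (X : ℂ[X]) + Polynomial.C (1 : ℂ)) ^ ((D : ℤ) - k).toNat), ?_, ?_⟩
    · refine natDegree_sum_le_of_forall_le _ _ fun k hk => ?_
      rw [Finset.mem_Icc] at hk
      refine (natDegree_C_mul_le _ _).trans (natDegree_mul_le.trans ?_)
      have h1 := natDegree_pow_le_of_le (k + D).toNat hA1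
      have h2 := natDegree_pow_le_of_le ((D : ℤ) - k).toNat hB1
      rw [mul_one] at h1 h2
      omega
    · intro u
      rw [eval_finsetSum]
      simp only [eval_mul, eval_C, eval_pow, eval_add, eval_X]
      rw [Complex.ofReal_mul, hf, Finset.sum_mul]
      refine Finset.sum_congr rfl fun k hk => ?_
      conv_rhs => rw [mul_assoc, cexp_int_mul_halfAngle D hk c u]
      simp only [mul_assoc]
  refine ⟨∑ n ∈ Finset.range (2 * D + 1), Polynomial.C ((Q.coeff n).re) * X ^ n, ?_, ?_⟩
  · exact natDegree_sum_le_of_forall_le _ _ fun n hn =>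
      (natDegree_C_mul_X_pow_le _ _).trans (by have := Finset.mem_range.1 hn; omega)
  · intro u
    rw [eval_finsetSum]
    simp only [eval_mul, eval_C, eval_pow, eval_X]
    have h := hQeval u
    rw [eval_eq_sum_range' (lt_of_le_of_lt hQdeg (by omega) : Q.natDegree < 2 * D + 1)] at h
    have h' := congrArg Complex.re h
    rw [Complex.ofReal_re, Complex.re_sum] at h'
    rw [← h']
    refine Finset.sum_congr rfl fun n _ => ?_
    rw [← Complex.ofReal_pow, Complex.mul_re, Complex.ofReal_re, Complex.ofReal_im, mul_zero, sub_zero]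

/-! ### Sublevel sets: Remez, and the Lipschitz chart -/

/-- **Sublevel form of the weak Remez inequality** (contrapositive of
`CarberyWright.remez_weak`): if `deg q ≤ d`, `S ⊆ [a, b]`, `|q| ≤ B` on `S`, and at some point
`t ∈ [a, b]` one has `|q(t)| > e (8e(b-a)/s₀)^d B`, then `|S| ≤ s₀`. [folklore] -/
theorem volume_le_of_remez {d : ℕ} {q : ℝ[X]} (hq : q.natDegree ≤ d) {a b s₀ B : ℝ}
    (hs₀ : 0 < s₀) (hB : 0 ≤ B) {S : Set ℝ} (hSsub : S ⊆ Icc a b) (hSB : ∀ y ∈ S, |q.eval y| ≤ B)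
    {t : ℝ} (ht : t ∈ Icc a b)
    (hlt : Real.exp 1 * (8 * Real.exp 1 * (b - a) / s₀) ^ d * B < |q.eval t|) :
    volume S ≤ ENNReal.ofReal s₀ := by
  by_contra h
  rw [not_le] at h
  obtain ⟨s, -, h1, h2⟩ := ENNReal.lt_iff_exists_real_btwn.1 h
  rw [ENNReal.ofReal_lt_ofReal_iff_of_nonneg hs₀.le] at h1
  have hs : 0 < s := hs₀.trans h1
  have hrem := Literature.Analysis.Approximation.CarberyWright.remez_weak hq hs hSsub h2.le hSB ht
  have hba : 0 ≤ b - a := by linarith [ht.1, ht.2]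
  have hfrac : 8 * Real.exp 1 * (b - a) / s ≤ 8 * Real.exp 1 * (b - a) / s₀ :=
    div_le_div_of_nonneg_left (by positivity) hs₀ h1.le
  have hpow := pow_le_pow_left₀ (by positivity) hfrac d
  have := mul_le_mul_of_nonneg_right (mul_le_mul_of_nonneg_left hpow (Real.exp_pos 1).le) hB
  linarith

/-- The half-angle chart `u ↦ c + 2 arctan u` is `2`-Lipschitz, so it at most doubles Lebesgue
measure: `|φ(S)| ≤ 2 |S|` (via `μH[1] = volume` on `ℝ`). [folklore] -/
theorem volume_image_halfAngle_le (c : ℝ) (S : Set ℝ) :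
    volume ((fun u : ℝ => c + 2 * Real.arctan u) '' S) ≤ 2 * volume S := by
  have hL : LipschitzWith 2 (fun u : ℝ => c + 2 * Real.arctan u) := by
    apply lipschitzWith_of_nnnorm_deriv_le ((Real.differentiable_arctan.const_mul 2).const_add c)
    intro x
    have hd : deriv (fun u : ℝ => c + 2 * Real.arctan u) x = 2 / (1 + x ^ 2) := by
      rw [(((Real.hasDerivAt_arctan x).const_mul 2).const_add c).deriv]
      ring
    rw [hd, ← NNReal.coe_le_coe, coe_nnnorm, Real.norm_of_nonneg (by positivity), NNReal.coe_ofNat,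
      div_le_iff₀ (by positivity)]
    nlinarith [sq_nonneg x]
  have h := hL.hausdorffMeasure_image_le zero_le_one S
  rw [MeasureTheory.hausdorffMeasure_real, ENNReal.rpow_one] at h
  exact_mod_cast h

/-- **One arc.** Let `f ≥ 0` be a real trigonometric polynomial of degree `≤ D` taking the value
`M > 0` at a point `c + 2 arctan u₀` (`|u₀| ≤ √3`) of the arc `J = [c - 2π/3, c + 2π/3]`. Then for
every `ε > 0`,
`|{t ∈ J : f(t) ≤ ε M}| ≤ 2 · 16e√3 · (2e·4^D·ε)^{1/(2D+2)}`
(half-angle chart + `volume_le_of_remez` for `R(u) = f(c + 2arctan u)(1+u²)^D`, `deg R ≤ 2D ≤ 2D+2`,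
on `[-√3, √3]`). [folklore] -/
theorem trigPoly_arc_sublevel {D : ℕ} {a : ℤ → ℂ} {f : ℝ → ℝ}
    (hf : ∀ t : ℝ, ((f t : ℝ) : ℂ) = ∑ k ∈ Finset.Icc (-(D : ℤ)) D, a k * cexp ((k : ℂ) * (t : ℂ) * I))
    (hpos : ∀ t, 0 ≤ f t) {M : ℝ} (hM0 : 0 < M) {ε : ℝ} (hε : 0 < ε)
    (c : ℝ) {u₀ : ℝ} (hu₀ : u₀ ∈ Icc (-√3) √3) (hfu₀ : f (c + 2 * Real.arctan u₀) = M) :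
    volume {t ∈ Icc (c - 2 * π / 3) (c + 2 * π / 3) | f t ≤ ε * M} ≤
      ENNReal.ofReal (2 * (16 * Real.exp 1 * √3 *
        (2 * Real.exp 1 * 4 ^ D * ε) ^ ((2 * D + 2 : ℕ) : ℝ)⁻¹)) := by
  obtain ⟨R, hRdeg, hR⟩ := trigPoly_halfAngle_poly hf c
  set ρ : ℝ := (2 * Real.exp 1 * 4 ^ D * ε) ^ ((2 * D + 2 : ℕ) : ℝ)⁻¹ with hρ_def
  have hρ : 0 < ρ := Real.rpow_pos_of_pos (by positivity) _
  have hρpow : ρ ^ (2 * D + 2) = 2 * Real.exp 1 * 4 ^ D * ε :=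
    Real.rpow_inv_natCast_pow (by positivity) (by omega)
  set S : Set ℝ := {u ∈ Icc (-√3) √3 | f (c + 2 * Real.arctan u) ≤ ε * M} with hS_def
  -- Step 1: the chart-side sublevel set is small, by Remez.
  have hS : volume S ≤ ENNReal.ofReal (16 * Real.exp 1 * √3 * ρ) := by
    have hdeg : R.natDegree ≤ 2 * D + 2 := hRdeg.trans (by omega)
    refine volume_le_of_remez hdeg (by positivity) (by positivity : (0 : ℝ) ≤ ε * M * 4 ^ D)
      (fun u hu => hu.1) ?_ hu₀ ?_
    · rintro u ⟨hu, hfu⟩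
      rw [hR u, abs_of_nonneg (mul_nonneg (hpos _) (by positivity))]
      have h4 : (1 + u ^ 2) ^ D ≤ 4 ^ D := pow_le_pow_left₀ (by positivity)
        (by nlinarith [hu.1, hu.2, Real.sqrt_nonneg 3, Real.sq_sqrt (zero_le_three (α := ℝ))]) D
      exact mul_le_mul hfu h4 (by positivity) (by positivity)
    · rw [hR u₀, hfu₀, abs_of_nonneg (by positivity)]
      have h1 : 8 * Real.exp 1 * (√3 - -√3) / (16 * Real.exp 1 * √3 * ρ) = ρ⁻¹ := by
        field_simp
        ring
      rw [h1, inv_pow, hρpow]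
      have h2 : Real.exp 1 * (2 * Real.exp 1 * 4 ^ D * ε)⁻¹ * (ε * M * 4 ^ D) = M / 2 := by
        field_simp
      rw [h2]
      have h3 : M ≤ M * (1 + u₀ ^ 2) ^ D :=
        le_mul_of_one_le_right hM0.le (one_le_pow₀ (by nlinarith [sq_nonneg u₀]))
      linarith
  -- Step 2: the arc-side sublevel set is the image of `S` under the chart.
  have hsub : {t ∈ Icc (c - 2 * π / 3) (c + 2 * π / 3) | f t ≤ ε * M} ⊆
      (fun u : ℝ => c + 2 * Real.arctan u) '' S := by
    rintro t ⟨ht, hft⟩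
    have hlo : -(π / 2) < (t - c) / 2 := by linarith [ht.1, Real.pi_pos]
    have hhi : (t - c) / 2 < π / 2 := by linarith [ht.2, Real.pi_pos]
    have hat : Real.arctan (Real.tan ((t - c) / 2)) = (t - c) / 2 := Real.arctan_tan hlo hhi
    have ht' : c + 2 * Real.arctan (Real.tan ((t - c) / 2)) = t := by rw [hat]; ring
    refine ⟨Real.tan ((t - c) / 2), ⟨⟨?_, ?_⟩, by rw [ht']; exact hft⟩, ht'⟩
    · rw [← Real.arctan_le_arctan_iff, Real.arctan_neg, Real.arctan_sqrt_three, hat]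
      linarith [ht.1]
    · rw [← Real.arctan_le_arctan_iff, Real.arctan_sqrt_three, hat]
      linarith [ht.2]
  -- Step 3: the chart at most doubles measure.
  calc volume {t ∈ Icc (c - 2 * π / 3) (c + 2 * π / 3) | f t ≤ ε * M}
      ≤ volume ((fun u : ℝ => c + 2 * Real.arctan u) '' S) := measure_mono hsub
    _ ≤ 2 * volume S := volume_image_halfAngle_le c S
    _ ≤ 2 * ENNReal.ofReal (16 * Real.exp 1 * √3 * ρ) := by gcongr
    _ = ENNReal.ofReal (2 * (16 * Real.exp 1 * √3 * ρ)) := by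
        rw [ENNReal.ofReal_mul zero_le_two, ENNReal.ofReal_ofNat]

/-! ### The small-ball theorem -/

/-- **Mean-relative small balls for non-negative trigonometric polynomials.** For every degree `D`
there are `C, c > 0` (here `c = 1/(2D+2)`, `C = 288 e √3 (2e 4^D)^c`) such that for every real
trigonometric polynomial `f ≥ 0` of degree `≤ D` with `∫_{[-π,π]} f > 0` and every `ε > 0`,
`|{t ∈ [-π, π] : f(t) ≤ ε ⨍ f}| ≤ C ε^c`, `⨍ f = (∫_{[-π,π]} f)/(2π)` (a Remez-type small-ball
inequality; Remez 1936, Borwein–Erdélyi GTM 161 §5.1, Carbery–Wright 2001; proof in the module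
docstring). [folklore] -/
theorem trigPoly_smallBall :
    ∀ D : ℕ, ∃ C c : ℝ, 0 < C ∧ 0 < c ∧ ∀ f : ℝ → ℝ,
      (∃ a : ℤ → ℂ, ∀ t : ℝ, ((f t : ℝ) : ℂ) =
        ∑ k ∈ Finset.Icc (-(D : ℤ)) D, a k * Complex.exp ((k : ℂ) * (t : ℂ) * Complex.I)) →
      (∀ t, 0 ≤ f t) → 0 < ∫ t in Set.Icc (-π) π, f t → ∀ ε : ℝ, 0 < ε →
        volume {t ∈ Set.Icc (-π) π | f t ≤ ε * ((∫ s in Set.Icc (-π) π, f s) / (2 * π))} ≤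
          ENNReal.ofReal (C * ε ^ c) := by
  intro D
  set c₀ : ℝ := ((2 * D + 2 : ℕ) : ℝ)⁻¹ with hc₀
  refine ⟨9 * (2 * (16 * Real.exp 1 * √3 * (2 * Real.exp 1 * 4 ^ D) ^ c₀)), c₀, by positivity,
    by positivity, ?_⟩
  rintro f ⟨a, hf⟩ hpos hint ε hε
  have hcont := trigPoly_continuous hf
  have hper := trigPoly_periodic hf
  -- a maximum point `tm ∈ [-π, π]`, global by periodicity
  obtain ⟨tm, htm, hmax⟩ := isCompact_Icc.exists_isMaxOn
    (nonempty_Icc.2 (by linarith [Real.pi_pos] : -π ≤ π)) hcont.continuousOn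
  set M := f tm with hM_def
  have hM : ∀ t, f t ≤ M := by
    intro t
    obtain ⟨y, hy, hfy⟩ := hper.exists_mem_Ico Real.two_pi_pos t (-π)
    rw [hfy]
    exact hmax ⟨hy.1, by linarith [hy.2]⟩
  -- mean ≤ max, max > 0
  have hintle : ∫ s in Icc (-π) π, f s ≤ 2 * π * M := by
    calc ∫ s in Icc (-π) π, f s ≤ ∫ _ in Icc (-π) π, M :=
          setIntegral_mono_on hcont.integrableOn_Icc (integrableOn_const (by
            rw [Real.volume_Icc]; exact ENNReal.ofReal_ne_top)) measurableSet_Icc fun t _ => hM t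
      _ = 2 * π * M := by
          rw [setIntegral_const, Real.volume_real_Icc_of_le (by linarith [Real.pi_pos]), smul_eq_mul]
          ring
  have hM0 : 0 < M := by nlinarith [Real.pi_pos]
  have hμM : ε * ((∫ s in Icc (-π) π, f s) / (2 * π)) ≤ ε * M := by
    refine mul_le_mul_of_nonneg_left ?_ hε.le
    rw [div_le_iff₀ (by positivity)]
    linarith
  -- one period around `tm`: three arcs (`trigPoly_arc_sublevel`), each of measure `≤ s₁`
  set s₁ : ℝ := 2 * (16 * Real.exp 1 * √3 * (2 * Real.exp 1 * 4 ^ D * ε) ^ c₀) with hs₁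
  have h3 : (0 : ℝ) ≤ √3 := Real.sqrt_nonneg 3
  set E : Set ℝ := {t ∈ Icc (tm - π) (tm + π) | f t ≤ ε * M} with hE_def
  have hEvol : volume E ≤ 3 * ENNReal.ofReal s₁ := by
    have hsub : E ⊆ {t ∈ Icc (tm - 2 * π / 3) (tm + 2 * π / 3) | f t ≤ ε * M} ∪
        {t ∈ Icc (tm + 2 * π / 3 - 2 * π / 3) (tm + 2 * π / 3 + 2 * π / 3) | f t ≤ ε * M} ∪
        {t ∈ Icc (tm - 2 * π / 3 - 2 * π / 3) (tm - 2 * π / 3 + 2 * π / 3) | f t ≤ ε * M} := by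
      rintro t ⟨ht, hft⟩
      rcases le_or_gt t (tm + 2 * π / 3) with h1 | h1
      · rcases le_or_gt (tm - 2 * π / 3) t with h2 | h2
        · exact Or.inl (Or.inl ⟨⟨h2, h1⟩, hft⟩)
        · exact Or.inr ⟨⟨by linarith [ht.1, Real.pi_pos], by linarith [Real.pi_pos]⟩, hft⟩
      · exact Or.inl (Or.inr ⟨⟨by linarith [Real.pi_pos], by linarith [ht.2, Real.pi_pos]⟩, hft⟩)
    calc volume E ≤ _ := (measure_mono hsub).trans
          ((measure_union_le _ _).trans (add_le_add (measure_union_le _ _) le_rfl))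
      _ ≤ ENNReal.ofReal s₁ + ENNReal.ofReal s₁ + ENNReal.ofReal s₁ := by
          gcongr
          · exact trigPoly_arc_sublevel hf hpos hM0 hε tm (u₀ := 0) ⟨by linarith, h3⟩
              (by rw [hM_def, Real.arctan_zero, mul_zero, add_zero])
          · exact trigPoly_arc_sublevel hf hpos hM0 hε _ (u₀ := -√3) ⟨le_rfl, by linarith⟩
              (by rw [hM_def, Real.arctan_neg, Real.arctan_sqrt_three]; ring_nf)
          · exact trigPoly_arc_sublevel hf hpos hM0 hε _ (u₀ := √3) ⟨by linarith, le_rfl⟩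
              (by rw [hM_def, Real.arctan_sqrt_three]; ring_nf)
      _ = 3 * ENNReal.ofReal s₁ := by ring
  -- `[-π, π]` is covered by the period and its two translates
  have hAsub : {t ∈ Icc (-π) π | f t ≤ ε * ((∫ s in Icc (-π) π, f s) / (2 * π))} ⊆
      E ∪ (fun t => t + 2 * π) ⁻¹' E ∪ (fun t => t + -(2 * π)) ⁻¹' E := by
    rintro t ⟨ht, hft⟩
    have hft' : f t ≤ ε * M := hft.trans hμM
    rcases lt_or_ge t (tm - π) with h1 | h1
    · refine Or.inl (Or.inr ⟨⟨by linarith [ht.1, htm.2], by linarith⟩, ?_⟩)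
      show f (t + 2 * π) ≤ ε * M
      rwa [hper t]
    rcases le_or_gt t (tm + π) with h2 | h2
    · exact Or.inl (Or.inl ⟨⟨h1, h2⟩, hft'⟩)
    · refine Or.inr ⟨⟨by linarith, by linarith [ht.2, htm.1]⟩, ?_⟩
      show f (t + -(2 * π)) ≤ ε * M
      rwa [← sub_eq_add_neg, hper.sub_eq]
  -- assemble
  have hfin : (9 : ℝ≥0∞) * ENNReal.ofReal s₁ =
      ENNReal.ofReal (9 * (2 * (16 * Real.exp 1 * √3 * (2 * Real.exp 1 * 4 ^ D) ^ c₀)) * ε ^ c₀) := by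
    rw [hs₁, Real.mul_rpow (by positivity) hε.le, ← ENNReal.ofReal_ofNat 9,
      ← ENNReal.ofReal_mul (by norm_num)]
    congr 1
    ring
  calc volume {t ∈ Icc (-π) π | f t ≤ ε * ((∫ s in Icc (-π) π, f s) / (2 * π))}
      ≤ volume E + volume ((fun t => t + 2 * π) ⁻¹' E) + volume ((fun t => t + -(2 * π)) ⁻¹' E) :=
        (measure_mono hAsub).trans
          ((measure_union_le _ _).trans (add_le_add (measure_union_le _ _) le_rfl))
    _ = volume E + volume E + volume E := by
        rw [measure_preimage_add_right, measure_preimage_add_right]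
    _ ≤ 3 * ENNReal.ofReal s₁ + 3 * ENNReal.ofReal s₁ + 3 * ENNReal.ofReal s₁ := by gcongr
    _ = 9 * ENNReal.ofReal s₁ := by ring
    _ = _ := hfin

end Literature.Analysis.Fourier
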